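import Mathlib
import Summits.Ventures.PercRepro2.HCov
import Summits.Ventures.PercRepro2.EdgeCubic
import Summits.Ventures.PercRepro2.OEdgeCubic

/-!
# The two Bernstein coefficients of `Gc` at an a₃–o edge, in the collapsed masses
(blind cell PercRepro2, p5 g14; `proofs/P5-OEDGE.md` §2)

At `p₁ = p[e↦1]` with `ends e = s(a₃, o)` the twelve pattern masses collapse (OEdgeCubic.lean):
`D_o = 0`, `PDbo = 0`, `EQbo = EQb3o = EQb3` and `EQo = EQ3o = EQ3` (`Do_one_eq_zero`, …).
Substituting into `B1Poly` / `B2Poly` gives the explicit forms (**`B1_eq_o`**, **`B2_eq_o`**):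

  `B2 = Q₁·D₁·Y + D₁·S_b¹·Z + Q₁·D_o⁰·(EQb3¹ + PDb¹) − D_o⁰·S_b¹·EQ3¹`,
  `B1 = (Q₁·D₀ + Q₀·D₁)·Y + (S_b¹·D₀ + S_b⁰·D₁)·Z + Q₁·D_o⁰·(EQb3⁰ + PDb⁰) + Q₀·D_o⁰·(EQb3¹ + PDb¹)
        − S_b¹·D_o⁰·EQ3⁰ − S_b⁰·D_o⁰·EQ3¹`,

with `Y := EQbo⁰ − EQb3o⁰ − PDbo⁰` (`= ⟨1_Q σ_b H − 1_A U_b U_o⟩`), `Z := EQ3o⁰ − EQo⁰` (`= −⟨1_Q H⟩`)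
and `S_b = −gap = ⟨1_Q σ_b⟩` —
the paper identities `3b₂ = D′Q′Y + D′S_b′Z + Q′Db′D_o + Q′D_oX′ − D_oS_b′S′` and its `b₁` twin of
P5-OEDGE.md §2 (there `3b₁ = Q₀²Q₁[(α + α′)G₀ + P1]`, `3b₂ = Q₀Q₁²[α′G₀ + P2]`), now kernel-checked
as statements about the landed `B1`, `B2`.
-/

namespace Summit.Ventures.PercRepro2

open UnionCluster

namespace CovForm

namespace OEdge

open EdgeLine

section Collapse

variable {V : Type*} {E : Type*} [Fintype E] [DecidableEq E] {R : Type*} [Field R] [LinearOrder R]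

variable {ends : E → Sym2 V} {e : E} {o a₃ : V}

omit [LinearOrder R] in
/-- `D_o = 0` at `p[e↦1]`. -/
lemma Do_one_eq_zero (p : E → R) (hends : ends e = s(a₃, o)) (a₁ a₂ : V) :
    Do (Function.update p e 1) ends o a₁ a₂ a₃ = 0 := by
  obtain ⟨h1, h2, -, -, -, -, -, -⟩ := bare_collapse p hends a₁ a₂
  unfold Do
  rw [h1, h2, add_zero]

omit [LinearOrder R] in
/-- `PDbo = 0` at `p[e↦1]`. -/
lemma PDbo_one_eq_zero (p : E → R) (hends : ends e = s(a₃, o)) (a₁ a₂ b : V) :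
    PDbo (Function.update p e 1) ends o a₁ a₂ a₃ b = 0 := by
  unfold PDbo
  simp only [prob_one_PD_oL_inter p hends a₁ a₂, prob_one_PD_oH_inter p hends a₁ a₂, add_zero]

omit [LinearOrder R] in
/-- `EQbo = EQb3` at `p[e↦1]` (`σ_o = σ₃`). -/
lemma EQbo_one_eq (p : E → R) (hends : ends e = s(a₃, o)) (a₁ a₂ b : V) :
    EQbo (Function.update p e 1) ends o a₁ a₂ b = EQb3 (Function.update p e 1) ends a₁ a₂ a₃ b := by
  unfold EQbo EQb3
  rw [prob_one_Q_oL_inter p hends a₁ a₂, prob_one_Q_oH_inter p hends a₁ a₂,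
    prob_one_Q_oH_inter p hends a₁ a₂, prob_one_Q_oL_inter p hends a₁ a₂]

omit [LinearOrder R] in
/-- `EQb3o = EQb3` at `p[e↦1]`. -/
lemma EQb3o_one_eq (p : E → R) (hends : ends e = s(a₃, o)) (a₁ a₂ b : V) :
    EQb3o (Function.update p e 1) ends o a₁ a₂ a₃ b =
      EQb3 (Function.update p e 1) ends a₁ a₂ a₃ b := by
  unfold EQb3o EQb3
  rw [prob_one_T'_oL_inter p hends a₁ a₂, prob_one_T'_oH_inter p hends a₁ a₂,
    prob_one_T_oL_inter p hends a₁ a₂, prob_one_T_oH_inter p hends a₁ a₂,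
    prob_one_T_oL_inter p hends a₁ a₂, prob_one_T_oH_inter p hends a₁ a₂,
    prob_one_T'_oL_inter p hends a₁ a₂, prob_one_T'_oH_inter p hends a₁ a₂]
  ring

omit [LinearOrder R] in
/-- `EQo = EQ3` at `p[e↦1]`. -/
lemma EQo_one_eq (p : E → R) (hends : ends e = s(a₃, o)) (a₁ a₂ : V) :
    EQo (Function.update p e 1) ends o a₁ a₂ = EQ3 (Function.update p e 1) ends a₁ a₂ a₃ := by
  obtain ⟨-, -, h3, h4, -, -, -, -⟩ := bare_collapse p hends a₁ a₂
  unfold EQo EQ3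
  rw [h3, h4]

omit [LinearOrder R] in
/-- `EQ3o = EQ3` at `p[e↦1]`. -/
lemma EQ3o_one_eq (p : E → R) (hends : ends e = s(a₃, o)) (a₁ a₂ : V) :
    EQ3o (Function.update p e 1) ends o a₁ a₂ a₃ = EQ3 (Function.update p e 1) ends a₁ a₂ a₃ := by
  obtain ⟨-, -, -, -, h5, h6, h7, h8⟩ := bare_collapse p hends a₁ a₂
  unfold EQ3o EQ3
  rw [h5, h6, h7, h8]
  ring

omit [LinearOrder R] in
/-- **`B2` at an a₃–o edge, in the collapsed masses** (the paper identity
`3b₂ = D′Q′Y + D′S_b′Z + Q′Db′D_o + Q′D_oX′ − D_oS_b′S′` of P5-OEDGE.md §2). -/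
theorem B2_eq_o (p : E → R) (hends : ends e = s(a₃, o)) (a₁ a₂ b : V) :
    B2 p ends o a₁ a₂ a₃ b e =
      prob (Function.update p e 1) (avoidAll ends a₂ {a₁}) *
          prob (Function.update p e 1) (PDEvent ends a₁ a₂ a₃) *
          (EQbo (Function.update p e 0) ends o a₁ a₂ b -
            EQb3o (Function.update p e 0) ends o a₁ a₂ a₃ b -
            PDbo (Function.update p e 0) ends o a₁ a₂ a₃ b) +
        prob (Function.update p e 1) (PDEvent ends a₁ a₂ a₃) *
          (-gap (Function.update p e 1) ends a₁ a₂ b) *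
          (EQ3o (Function.update p e 0) ends o a₁ a₂ a₃ - EQo (Function.update p e 0) ends o a₁ a₂) +
        prob (Function.update p e 1) (avoidAll ends a₂ {a₁}) * Do (Function.update p e 0) ends o a₁ a₂ a₃ *
          (EQb3 (Function.update p e 1) ends a₁ a₂ a₃ b + PDb (Function.update p e 1) ends a₁ a₂ a₃ b) -
        Do (Function.update p e 0) ends o a₁ a₂ a₃ * (-gap (Function.update p e 1) ends a₁ a₂ b) *
          EQ3 (Function.update p e 1) ends a₁ a₂ a₃ := by
  unfold B2 B2Poly polar2
  rw [Do_one_eq_zero p hends a₁ a₂, PDbo_one_eq_zero p hends a₁ a₂ b, EQbo_one_eq p hends a₁ a₂ b,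
    EQb3o_one_eq p hends a₁ a₂ b, EQo_one_eq p hends a₁ a₂, EQ3o_one_eq p hends a₁ a₂]
  ring

omit [LinearOrder R] in
/-- **`B1` at an a₃–o edge, in the collapsed masses** (the `b₁` twin of `B2_eq_o`). -/
theorem B1_eq_o (p : E → R) (hends : ends e = s(a₃, o)) (a₁ a₂ b : V) :
    B1 p ends o a₁ a₂ a₃ b e =
      prob (Function.update p e 0) (avoidAll ends a₂ {a₁}) *
          prob (Function.update p e 1) (PDEvent ends a₁ a₂ a₃) *
          (EQbo (Function.update p e 0) ends o a₁ a₂ b -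
            EQb3o (Function.update p e 0) ends o a₁ a₂ a₃ b -
            PDbo (Function.update p e 0) ends o a₁ a₂ a₃ b) +
        prob (Function.update p e 1) (PDEvent ends a₁ a₂ a₃) *
          (-gap (Function.update p e 0) ends a₁ a₂ b) *
          (EQ3o (Function.update p e 0) ends o a₁ a₂ a₃ - EQo (Function.update p e 0) ends o a₁ a₂) +
        prob (Function.update p e 1) (avoidAll ends a₂ {a₁}) * Do (Function.update p e 0) ends o a₁ a₂ a₃ *
          (EQb3 (Function.update p e 0) ends a₁ a₂ a₃ b + PDb (Function.update p e 0) ends a₁ a₂ a₃ b) +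
        prob (Function.update p e 1) (avoidAll ends a₂ {a₁}) *
          prob (Function.update p e 0) (PDEvent ends a₁ a₂ a₃) *
          (EQbo (Function.update p e 0) ends o a₁ a₂ b -
            EQb3o (Function.update p e 0) ends o a₁ a₂ a₃ b -
            PDbo (Function.update p e 0) ends o a₁ a₂ a₃ b) +
        (-gap (Function.update p e 1) ends a₁ a₂ b) *
          (prob (Function.update p e 0) (PDEvent ends a₁ a₂ a₃) *
              (EQ3o (Function.update p e 0) ends o a₁ a₂ a₃ - EQo (Function.update p e 0) ends o a₁ a₂) -
            Do (Function.update p e 0) ends o a₁ a₂ a₃ * EQ3 (Function.update p e 0) ends a₁ a₂ a₃) +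
        prob (Function.update p e 0) (avoidAll ends a₂ {a₁}) * Do (Function.update p e 0) ends o a₁ a₂ a₃ *
          PDb (Function.update p e 1) ends a₁ a₂ a₃ b +
        Do (Function.update p e 0) ends o a₁ a₂ a₃ *
          (prob (Function.update p e 0) (avoidAll ends a₂ {a₁}) *
              EQb3 (Function.update p e 1) ends a₁ a₂ a₃ b -
            (-gap (Function.update p e 0) ends a₁ a₂ b) * EQ3 (Function.update p e 1) ends a₁ a₂ a₃) := by
  unfold B1 B1Poly polar1
  rw [Do_one_eq_zero p hends a₁ a₂, PDbo_one_eq_zero p hends a₁ a₂ b, EQbo_one_eq p hends a₁ a₂ b,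
    EQb3o_one_eq p hends a₁ a₂ b, EQo_one_eq p hends a₁ a₂, EQ3o_one_eq p hends a₁ a₂]
  ring

end Collapse

end OEdge

end CovForm

end Summit.Ventures.PercRepro2
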